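import Mathlib.Tactic.Linarith
import Mathlib.Tactic.Ring
import Mathlib.Tactic.NormNum
import Mathlib.Tactic.Positivity
import Mathlib.Data.ZMod.Basic
import HarnessLib

/-!
# The Euler-form barrier, part 2: the parity sieve on the ramified principal planes and the odd-rank ι-count

Family `hodge`, layer `Literature/AlgebraicGeometry/HodgeTheory`. Companion to `SemiregularityEulerFormBarrier.lean` (same ladder note,
`papers/HodgeConjecture/hodge-weil-ladder`, section "The Euler-form barrier", Prop. 2.2 / Cor. 2.3 / (5.6″)); kept in a separate file to respect
the 400-line convention. Fully PROVED elementary statements (no named fact, no definition); the geometric dictionary is that of the companion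
file: `v = (v₀,…,v₄)` are the coordinates of `ch(F)` in the basis `Θ^j/j!` on a principally polarized abelian fourfold, the Euler form is
`χ(F,F) = 2v₀v₄ − 8v₁v₃ + 6v₂²`, the Γ-saturated parity sieve (conditional on the 2025 claim [`EngelDeGaayFortmanSchreieder2025`], Thm 1.1:
on a very general ppav fourfold `c₂`, `c₃` of every object are even multiples of the minimal classes) is `v₁ ≡ v₂ ≡ v₃ (mod 2)`, and for
`K = ℚ(√-d)` with `d ≡ 1, 2 (mod 4)` the integral classes on the principal secant plane form Markman's lattice `ℤα + ℤβ`
[`Markman2025SecantWeil`, §8.1] with `v = bα + aβ = (b, a, −db, −da, d²b)`.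

## What is proved

* `ramifiedPlane_euler`: Euler form `8d(db² + a²)` on `ℤα + ℤβ`;
* `ramifiedPlane_sieve_even/_odd`: the sieve reads `a ≡ 0 (mod 2)` for `d` even, `a ≡ b (mod 2)` for `d` odd;
* `ramifiedPlane_min_even/_odd`, `ramifiedPlane_exceeds_window`: sieved Euler forms are `≥ min(8d², 32d)` resp. `≥ min(8d(d+1), 32d)`, all `> 14`
  — with the companion file's `principalPlane_sieve_of_odd` (2 inert) and `principalPlane_min` (2 split) this discharges the hypotheses of
  `sqrtMinus7_unique_window` on the principal planes: on a very general ppav fourfold only `K = ℚ(√-7)` admits a sieve-passing secant class with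
  `χ ≤ 14` (the semiregularity window of a translation-rigid object);
* `odd_sq_ge_one`, `oddRank_design_void`: for an ι-equivariant object of ODD rank locally free along the 256 two-torsion points, the holomorphic
  Lefschetz number `χ_ι = (1/16)Σ(r₊−r₋)²` is `≥ 16`, so the ι-equivariant Lemma 8.3.4 (`χ + χ_ι + 4e₁^ι = 28`, companion file
  `lemma834_inv_design_eq`) is impossible once `χ ≥ 13`, in particular for `K = ℚ(√-7)`.
-/

namespace Literature.AlgebraicGeometry.HodgeTheory

section RamifiedPlane

/-- Markman's lattice `ℤα + ℤβ` (`ρ = 0`, `q = τ = 1`; saturated, [Markman2025SecantWeil, §8.1]): `v = bα + aβ = (b, a, −db, −da, d²b)`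
has Euler form `8d(db² + a²)` (= `eulerForm_secant_markman` at `ρ = 0`, `q = τ = 1`). [cite: Markman2025SecantWeil, §8.1] -/
theorem ramifiedPlane_euler (d a b : ℤ) :
    2 * b * (d ^ 2 * b) - 8 * a * (-(d * a)) + 6 * (-(d * b)) ^ 2 = 8 * d * (d * b ^ 2 + a ^ 2) := by
  ring

/-- Sieve on `ℤα + ℤβ`, `d = 2k` even: `v₁ ≡ v₂ ≡ v₃ (mod 2)` (`v₁ = a`, `v₂ = −db`, `v₃ = −da`) iff `a` is even. [folklore] -/
theorem ramifiedPlane_sieve_even (k a b : ℤ) :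
    ((a - (-(2 * k) * b)) % 2 = 0 ∧ ((-(2 * k) * b) - (-(2 * k) * a)) % 2 = 0) ↔ a % 2 = 0 := by
  constructor
  · rintro ⟨h1, _⟩
    have : (a - (-(2 * k) * b)) = a + 2 * (k * b) := by ring
    rw [this] at h1; omega
  · intro ha
    constructor
    · have : (a - (-(2 * k) * b)) = a + 2 * (k * b) := by ring
      rw [this]; omega
    · have : (-(2 * k) * b) - (-(2 * k) * a) = 2 * (k * (a - b)) := by ring
      rw [this]; omega

/-- Sieve on `ℤα + ℤβ`, `d = 2k+1` odd: `v₁ ≡ v₂ ≡ v₃ (mod 2)` iff `a ≡ b (mod 2)` (the ladder's gen-3 parity `s = b² + ad` even is the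
codimension-2 half). [folklore] -/
theorem ramifiedPlane_sieve_odd (k a b : ℤ) :
    ((a - (-(2 * k + 1) * b)) % 2 = 0 ∧ ((-(2 * k + 1) * b) - (-(2 * k + 1) * a)) % 2 = 0) ↔ (a - b) % 2 = 0 := by
  have e1 : (a - (-(2 * k + 1) * b)) = (a + b) + 2 * (k * b) := by ring
  have e2 : (-(2 * k + 1) * b) - (-(2 * k + 1) * a) = (a - b) + 2 * (k * (a - b)) := by ring
  rw [e1, e2]
  omega

/-- Sieved minima, `d` even `≥ 2`: a non-zero sieve-passing class on `ℤα + ℤβ` has Euler form `≥ 8d²` (if `b ≠ 0`) or `≥ 32d`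
(if `b = 0`, `a` even non-zero): `16·2 = 32` for `d = 2`, `192` for `d = 6`, … — always `> 14`. [folklore] -/
theorem ramifiedPlane_min_even (d a b : ℤ) (hd : 2 ≤ d) (ha : a % 2 = 0) (hab : a ≠ 0 ∨ b ≠ 0) :
    8 * d * d ≤ 8 * d * (d * b ^ 2 + a ^ 2) ∨ 32 * d ≤ 8 * d * (d * b ^ 2 + a ^ 2) := by
  by_cases hb : b = 0
  · subst hb
    have ha0 : a ≠ 0 := by rcases hab with h | h; exact h; exact absurd rfl h
    have : 4 ≤ a ^ 2 := by
      rcases Int.ne_iff_lt_or_gt.mp ha0 with h | h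
      · have : a ≤ -2 := by omega
        nlinarith
      · have : 2 ≤ a := by omega
        nlinarith
    have key : 4 ≤ d * (0:ℤ) ^ 2 + a ^ 2 := by nlinarith
    have h8 : (0:ℤ) ≤ 8 * d := by omega
    right; nlinarith [mul_le_mul_of_nonneg_left key h8]
  · have hb2 : 1 ≤ b ^ 2 := by
      rcases Int.ne_iff_lt_or_gt.mp hb with h | h <;> nlinarith
    have key : d ≤ d * b ^ 2 + a ^ 2 := by nlinarith [sq_nonneg a]
    have h8 : (0:ℤ) ≤ 8 * d := by omega
    left; nlinarith [mul_le_mul_of_nonneg_left key h8]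

/-- Sieved minima, `d` odd: a non-zero class on `ℤα + ℤβ` with `a ≡ b (mod 2)` has Euler form `≥ 8d(d+1)` (both odd, or both
non-zero) or `≥ 32d` (one of them zero, the other even non-zero): `16` for `d = 1`, `160` for `d = 5`, `416` for `d = 13`, …
[folklore] -/
theorem ramifiedPlane_min_odd (d a b : ℤ) (hd : 1 ≤ d) (hab2 : (a - b) % 2 = 0) (hab : a ≠ 0 ∨ b ≠ 0) :
    8 * d * (d + 1) ≤ 8 * d * (d * b ^ 2 + a ^ 2) ∨ 32 * d ≤ 8 * d * (d * b ^ 2 + a ^ 2) := by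
  by_cases hb : b = 0
  · subst hb
    have ha0 : a ≠ 0 := by rcases hab with h | h; exact h; exact absurd rfl h
    have hae : a % 2 = 0 := by omega
    have : 4 ≤ a ^ 2 := by
      rcases Int.ne_iff_lt_or_gt.mp ha0 with h | h
      · have : a ≤ -2 := by omega
        nlinarith
      · have : 2 ≤ a := by omega
        nlinarith
    have key : 4 ≤ d * (0:ℤ) ^ 2 + a ^ 2 := by nlinarith
    have h8 : (0:ℤ) ≤ 8 * d := by omega
    right; nlinarith [mul_le_mul_of_nonneg_left key h8]
  · by_cases ha : a = 0
    · subst ha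
      have hbe : b % 2 = 0 := by omega
      have hb4 : 4 ≤ b ^ 2 := by
        rcases Int.ne_iff_lt_or_gt.mp hb with h | h
        · have : b ≤ -2 := by omega
          nlinarith
        · have : 2 ≤ b := by omega
          nlinarith
      have key : 4 ≤ d * b ^ 2 + (0:ℤ) ^ 2 := by nlinarith
      have h8 : (0:ℤ) ≤ 8 * d := by omega
      right; nlinarith [mul_le_mul_of_nonneg_left key h8]
    · have hb2 : 1 ≤ b ^ 2 := by
        rcases Int.ne_iff_lt_or_gt.mp hb with h | h <;> nlinarith
      have ha2 : 1 ≤ a ^ 2 := by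
        rcases Int.ne_iff_lt_or_gt.mp ha with h | h <;> nlinarith
      have key : d + 1 ≤ d * b ^ 2 + a ^ 2 := by nlinarith
      have h8 : (0:ℤ) ≤ 8 * d := by omega
      left; nlinarith [mul_le_mul_of_nonneg_left key h8]

/-- All ramified sieved bounds exceed the semiregularity window `χ ≤ 14`: `8d(d+1) > 14`, `32d > 14` for `d ≥ 1`, `8d² > 14` for
`d ≥ 2`. Hence (with `principalPlane_sieve_of_odd`: inert `d` give `≥ 8d ≥ 24`) only the split case `2d ≤ 14`, `d ≡ 7 (mod 8)`, i.e.
`d = 7`, meets the window — the hypotheses of `sqrtMinus7_unique_window`, discharged on the principal planes. [folklore] -/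
theorem ramifiedPlane_exceeds_window (d : ℤ) (hd : 1 ≤ d) :
    14 < 8 * d * (d + 1) ∧ 14 < 32 * d ∧ (2 ≤ d → 14 < 8 * d * d) := by
  refine ⟨by nlinarith, by omega, fun h => by nlinarith⟩

end RamifiedPlane

section OddRank

/-- The square of an odd integer is `≥ 1`: at a fixed point of `ι` where an ι-equivariant sheaf of ODD rank is locally free,
`(r₊ − r₋)² ≥ 1` (`r₊ + r₋` odd forces `r₊ − r₋` odd). [folklore] -/
theorem odd_sq_ge_one (r : ℤ) (hr : r % 2 = 1) : 1 ≤ r ^ 2 := by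
  have : r ≠ 0 := by intro h; subst h; simp at hr
  rcases Int.ne_iff_lt_or_gt.mp this with h | h <;> nlinarith

/-- **ι-symmetry does not rescue Lemma 8.3.4 in odd rank.** With `χ_ι = (1/16)Σ_{p ∈ Y[2]}(r₊−r₋)²(p) ≥ 256/16 = 16` (odd rank,
locally free along `Y[2]`, holomorphic Lefschetz [AtiyahBott1968 §4]) and `e₁^ι ≥ 0`, the design equation `χ + χ_ι + 4e₁^ι = 28` of
`lemma834_inv_design_eq` is unsolvable once `χ ≥ 13`; for `K = ℚ(√-7)` (`χ ≥ 14`, Prop. 2.1) the ι-equivariant Lemma 8.3.4 is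
therefore void for every odd-rank object locally free along the 2-torsion points. [cite: AtiyahBott1968, §4 (holomorphic Lefschetz formula)] -/
theorem oddRank_design_void (χ χι e : ℤ) (hχι : 16 ≤ χι) (he : 0 ≤ e) (hχ : 13 ≤ χ) :
    χ + χι + 4 * e ≠ 28 := by
  omega

end OddRank



/-! ## Appendix (generation 4): rank-one designs on the finer lattice ("Theorem G bis", ladder note (5.9))

For `d ≡ 3 (mod 4)` (`𝒪_K = ℤ[ω]`, `ω² = ω − m`, `d = 4m − 1`) the rank-one integral classes on the principal secant plane are the Lucas classes
of `μ = (c−1) + ω` (companion file `principalPlane_lucas` with `b = 1`, `a = c − 1`): `v = (1, c, c−m, c−m−mc, c−m−2mc+m²) =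
ch(𝓘_W ⊗ 𝒪(cΘ) ⊗ P)` for a codimension-2 subscheme `W` with `ch(𝒪_W) = 1 − e^{−cΘ}·v`. `finerLattice_rankOne` computes `e^{−cΘ}v`
(so `[W] = (c² − c + m)·Θ²/2 = N(μ)·Θ²/2`, `ch₃(𝒪_W) = −(2c³ − 3c² + (2m+1)c − m)·Θ³/6`, `χ(𝒪_W) = 3c⁴ − 6c³ + (2m+4)c² − (2m+1)c − m² + m`)
and the Euler form `2(4m−1)(c² − c + m) = 2d·N(μ)`. This family is disjoint from Markman's lattice `ℤα + ℤβ` analysed by the ladder's gen-2 Theorem G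
(`[S] = (a² + d)Θ²/2`, Euler form `8d(a² + d)`). For a SMOOTH surface `W` Grothendieck–Riemann–Roch gives (as in Theorem G) `H² = 12s`,
`K_W·H = −8·(ch₃-coefficient)`, `K_W² = 6χ(𝒪_W) + 3s²`, `e(W) = 12χ − K²`; `sqrtMinus7_design_sFour` records the first admissible case for
`ℚ(√-7)`: `c = 2`, `s = 4`, `(H², K·H, K², χ, e) = (48, 96, 168, 20, 72)`, Euler form `56 = 14·4` — so by Theorem T(c) of the companion file its
`G₀`-semiregularity needs `|G₀| ≥ 4`, and `|G₀| = 4` puts `χ(F̄,F̄) = 14` exactly at the window. -/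

section FinerLattice

variable {R : Type*} [CommRing R]

/-- **Rank-one classes on the finer lattice.** With `v = (1, c, c−m, c−m−mc, c−m−2mc+m²)` (Lucas class of `μ = (c−1)+ω`, `ω² = ω − m`),
the untwisted class `u = e^{−cΘ}·v`, `u_k = Σ_j C(k,j)(−c)^{k−j}v_j`, is
`u = (1, 0, −(c²−c+m), 2c³−3c²+(2m+1)c−m, −3c⁴+6c³−(2m+4)c²+(2m+1)c+m²−m)`, so `ch(𝒪_W) = 1 − u` has
`[W] = (c² − c + m)Θ²/2`; and the Euler form of `v` is `2(4m−1)(c²−c+m)`. [folklore] -/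
theorem finerLattice_rankOne (m c : R) :
    let v₀ : R := 1
    let v₁ := c
    let v₂ := c - m
    let v₃ := c - m - m * c
    let v₄ := c - m - 2 * m * c + m ^ 2
    (v₀ = 1 ∧ -c * v₀ + v₁ = 0 ∧ c ^ 2 * v₀ - 2 * c * v₁ + v₂ = -(c ^ 2 - c + m) ∧
      -c ^ 3 * v₀ + 3 * c ^ 2 * v₁ - 3 * c * v₂ + v₃ = 2 * c ^ 3 - 3 * c ^ 2 + (2 * m + 1) * c - m ∧
      c ^ 4 * v₀ - 4 * c ^ 3 * v₁ + 6 * c ^ 2 * v₂ - 4 * c * v₃ + v₄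
        = -3 * c ^ 4 + 6 * c ^ 3 - (2 * m + 4) * c ^ 2 + (2 * m + 1) * c + m ^ 2 - m) ∧
    2 * v₀ * v₄ - 8 * v₁ * v₃ + 6 * v₂ ^ 2 = 2 * (4 * m - 1) * (c ^ 2 - c + m) := by
  intro v₀ v₁ v₂ v₃ v₄
  simp only [v₀, v₁, v₂, v₃, v₄]
  refine ⟨⟨trivial, by ring, by ring, by ring, by ring⟩, by ring⟩

/-- **The cheapest open rank-one design for `ℚ(√-7)` (ladder note (5.9)).** `m = 2` (`d = 7`), `c = 2` (`μ = 1 + ω`, `N(μ) = 4`):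
`v = (1, 2, 0, −4, −4)` (sieve `v₁ ≡ v₂ ≡ v₃` passed), `s = [W]/(Θ²/2) = 4` (`[W] = 2Θ²`), `ch₃(𝒪_W) = −12·Θ³/6`, `χ(𝒪_W) = 20`, Euler form
`56`; for a smooth `W`: `H² = 12s = 48`, `K·H = 96`, `K² = 6χ + 3s² = 168`, `e = 12χ − K² = 72`, within the Bogomolov–Miyaoka–Yau and Noether
ranges (`168 ≤ 9·20`, `168 ≥ 2·20 − 6`) and of general type (`K·H > 0`, `K² > 0`): numerically admissible — unlike `c ∈ {0,1}` (`e = −24 < 0`).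
`G₀`-semiregularity needs `56 ≤ 14·|G₀|`, i.e. `|G₀| ≥ 4`. [folklore] -/
theorem sqrtMinus7_design_sFour :
    let m : ℤ := 2
    let c : ℤ := 2
    let s := c ^ 2 - c + m
    let ch3 := -(2 * c ^ 3 - 3 * c ^ 2 + (2 * m + 1) * c - m)
    let χ := -(-3 * c ^ 4 + 6 * c ^ 3 - (2 * m + 4) * c ^ 2 + (2 * m + 1) * c + m ^ 2 - m)
    let Q := 2 * (4 * m - 1) * (c ^ 2 - c + m)
    let H2 := 12 * s
    let KH := -8 * ch3
    let K2 := 6 * χ + 3 * s ^ 2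
    let e := 12 * χ - K2
    (s = 4 ∧ ch3 = -12 ∧ χ = 20 ∧ Q = 56) ∧ (H2 = 48 ∧ KH = 96 ∧ K2 = 168 ∧ e = 72) ∧
    (K2 ≤ 9 * χ ∧ 2 * χ - 6 ≤ K2 ∧ 0 < KH ∧ 0 < K2) ∧
    ((c - (c - m)) % 2 = 0 ∧ ((c - m) - (c - m - m * c)) % 2 = 0) ∧
    (∀ G₀ : ℤ, Q ≤ 14 * G₀ ↔ 4 ≤ G₀) := by
  refine ⟨by norm_num, by norm_num, by norm_num, by norm_num, ?_⟩
  intro G₀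
  constructor <;> intro h <;> omega

/-- The cases `c ∈ {0, 1}` (`s = m`) are excluded for smooth `W` by `e(W) < 0` — for `d = 7`: `(χ, K², e) = (−2, 0, −24)`; an abelian variety
contains no ruled surface. [folklore] -/
theorem sqrtMinus7_design_cOne_excluded :
    let m : ℤ := 2
    let c : ℤ := 1
    let s := c ^ 2 - c + m
    let χ := -(-3 * c ^ 4 + 6 * c ^ 3 - (2 * m + 4) * c ^ 2 + (2 * m + 1) * c + m ^ 2 - m)
    let K2 := 6 * χ + 3 * s ^ 2
    s = 2 ∧ χ = -2 ∧ K2 = 0 ∧ 12 * χ - K2 = -24 := by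
  norm_num

end FinerLattice


/-! ## Appendix 2 (generation 4): generation by `Ext¹` excludes the weak criterion (ladder note Prop. 3.4)

For an abelian variety `HT^*(Y) = ∧^•HT¹(Y)` (so `HT² = ∧²HT¹`, `28 = C(8,2)`), HKR is an algebra isomorphism (`td = 1`) and
`ev_F : HH^*(Y) → Ext^*(F,F)` is a ring homomorphism; hence `im(ev²) = ev¹(HT¹)·ev¹(HT¹)`, which for a translation-rigid `F̄`
(`ev¹ : HT¹ ≅ Ext¹`) is the degree-2 part `Ext¹·Ext¹` of the subalgebra generated by `Ext¹`. With `k := dim ker(ev²) ≤ 16 = dim ann(ch F̄)`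
(`σ ∘ ev = ⌟ch`), `dim(Ext¹·Ext¹) = 28 − k`; the weak criterion is `k = 16`. If `Ext²` is generated by `Ext¹` ([Markman2025SecantWeil,
Lemma 8.3.7(1)], the genus-3 mechanism) then `e₂ = 28 − k`, and `e₂ = χ + 2e₁ − 2` with `e₁ = 8`, `χ ≥ 1` forces `k ≤ 13 < 16`:
the weak criterion fails (and `χ ≤ 14`). -/

section GenerationByExtOne

/-- **Prop. 3.4 of the ladder note: "generated by `Ext¹`" and the weak criterion are mutually exclusive on an abelian fourfold.**
`e₂ = 28 − k` (Ext² generated by Ext¹, translation-rigid: `im ev² = Ext¹·Ext¹ = Ext²`), `k ≤ 16` (`ker ev² ⊆ ann`), `e₂ = χ + 2e₁ − 2`,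
`e₁ = 8`, `χ ≥ 1` ⟹ `k = 14 − χ ≤ 13`, so `k ≠ 16`: `ker(ev) ≠ ann(ch)`, i.e. the weak criterion (W) fails (and `k ≥ 0` gives `χ ≤ 14`;
the extreme `χ = 14`, `k = 0` would be `Ext² = ∧²Ext¹ ≅ HT²`, an object obstructed to first order in every direction).
[cite: Markman2025SecantWeil, Lemma 8.3.7] -/
theorem generatedByExtOne_excludes_weak (e₂ χ k : ℤ) (hgen : e₂ = 28 - k) (hk0 : 0 ≤ k) (hk : k ≤ 16)
    (hSerre : e₂ = χ + 2 * 8 - 2) (hχ : 1 ≤ χ) : k = 14 - χ ∧ k ≠ 16 ∧ χ ≤ 14 := by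
  refine ⟨by omega, by omega, by omega⟩

/-- Conversely, under the weak criterion (`k = 16`) the classes generated by `Ext¹` span only `28 − 16 = 12` dimensions while
`e₂ = χ + 2e₁ − 2 ≥ χ + 14`: at least `χ + 2 ≥ 3` dimensions of `Ext²(F̄,F̄)` are "exotic" (not Yoneda products of degree-1 classes and
not controlled by `⌟ch`). [cite: Markman2025SecantWeil, Remark 8.3.5] -/
theorem weak_forces_exotic_ext_two (e₁ e₂ χ : ℤ) (hSerre : e₂ = χ + 2 * e₁ - 2) (he₁ : 8 ≤ e₁) (hχ : 1 ≤ χ) :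
    3 ≤ e₂ - (28 - 16) ∧ χ + 2 ≤ e₂ - (28 - 16) := by
  constructor <;> omega

end GenerationByExtOne


/-! ## Appendix 3 (generation 11): the ι-window at the object level — corrected survivor table, the quotient
integrality sieve, and the push-forward exclusion (ladder note `IOTA-WINDOW.md`)

Dictionary as above (`v = ch(F)` in the basis `Θ^j/j!`, Euler form `Q(v) = χ(F,F) = 2v₀v₄ − 8v₁v₃ + 6v₂²`). For an
`ι = −1`-equivariant simple object `F̄` on an abelian fourfold `Y` the `ι`-equivariant Lemma 8.3.4 — equivalently, on a
fourfold, `ι`-semiregularity (transpose duality `σ = obᵀ` restricted to `Ext²(F̄,F̄)^ι`) — is the DESIGN EQUATION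
`χ(F̄,F̄) + χ_ι + 4e₁^ι = 28` (`lemma834_inv_design_eq`), with `χ_ι = (1/16)Σ_{p ∈ Y[2]} t_p² ≥ 0`, `χ_ι ≡ χ (mod 2)`, and
`χ_ι ≥ 16` whenever the orbit of `ch` under `⟨⊗𝒪(Θ), Φ_𝒫, [1], ∨⟩` contains an odd rank ("ODD type": `v₀` or `v₄` odd for some,
equivalently every, member; `oddRank_design_void`).

(E2) The survivor list at `|G₀| = 1` printed in generation 4 (Prop. 4.2 (ii)) omitted the EVEN-type orbits, to which the
odd-rank bound does not apply; the corrected rows are recorded below as pure arithmetic (`tableA_*`).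

(QI) **Quotient integrality.** If `F = π^*F̄` for `π : X → Y = X/G₀` (`G₀ ⊂ X` finite, acting by translations), then
`ch(F) = π^*ch(F̄)` with `ch(F̄) ∈ H^{ev}(Y,ℤ)`: for a complex torus `T`, `K^*(T) = ∧^*(K¹(S¹)^{⊕2g})` (Künneth) and the Chern
character is a ring isomorphism onto `∧^*H¹(T,ℤ) = H^*(T,ℤ)`, so the Chern character of every topological vector bundle — hence of
every coherent sheaf and perfect complex — on a torus is INTEGRAL. Since `π^*H^{2k}(Y,ℤ) = ∧^{2k}Λ_Y^*` with `Λ_Y = H₁(Y,ℤ) ⊃ Λ =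
H₁(X,ℤ)`, `Λ_Y/Λ = G₀`, the class `v_k·Θ^k/k!` must lie in `∧^{2k}Λ_Y^*`. (a) If `G₀` contains an element `λ/N` of order `N`
(`λ ∈ Λ` primitive, completed to a symplectic basis `e₁ = λ, f₁, …`), then `ω ∈ ∧^{2k}Λ_{⟨λ/N⟩}^* ⟺ ι_{e₁}ω ∈ N·∧^{2k−1}Λ^*`, and
`ι_{e₁}(Θ^k/k!) = f₁^* ∧ (Θ')^{k−1}/(k−1)!` has unit coefficients: **`N ∣ v_k` for `k = 1, …, 4`**. (b) If `G₀ ⊇ ℤ/d₁ × ⋯ × ℤ/d_r`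
(`r ≤ 4`, `d_r ∣ ⋯ ∣ d₁`) then `d₁⋯d_{min(k,r)} ∣ v_k` (Smith normal form; the `2k × 2k` sub-Pfaffians of the unimodular `Θ`
through `≤ k` fixed basis vectors have gcd 1). (c) `|G₀| ∣ v₄ = χ(X,F)` and `|G₀| ∣ Q(v)`. All of (a)–(c) constrain ONE vector
`v = ch(F)`; they are conditions on `v mod L`, so the attainable residues are computed by closing the orbit modulo `L`
(script `iota_integrality.py`, exact). For `K = ℚ(√-7)` the outcome (all `N(x) ≤ 16`, `|G₀| ≤ 200`; EVEN classes to `N(x) = 32`):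
every ODD row of the quotient table is VOID, and the EVEN rows `v ∈ 2ℤ⁵` survive exactly at `|G₀| = N(x)/2`, where
`χ(F̄,F̄) = 28` forces `χ_ι = 0 = e₁^ι` (`chibar_twentyEight_rigid`). The four headline rows are kernel arithmetic below:
`Q = 14` admits no element of order 2 (`quotient_orderTwo_euler_mod_four`) nor of order 7 (`sqrtMinus7_minimal_no_orderSeven`:
`φ_v ≡ 4y(x+4y)³ (mod 7)` has a simple root, so no `SL₂`-transform is `≡ v₀x⁴`), `Q = 28` admits no group of order 4
(`quotient_orderFour_euler_mod_eight`), the class `2w` (`Q = 56`) admits no group of order 4 (`sqrtMinus7_doubled_no_orderFour`).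

(PF) **Push-forward exclusion.** If `F̄ ≅ F̄ ⊗ L_χ` (`χ ∈ Ĝ₀ ∖ 1`), then `F̄ = ρ_*G̃` for the cyclic étale cover `ρ` of `χ`, and
`Ext²_Y(F̄,F̄) = ⊕_g Ext²(t_g^*G̃, G̃) ⊇ Ext²(G̃,G̃)` `ι`-equivariantly with `χ(G̃,G̃) = χ(F̄,F̄)/deg ρ`; in the surviving `ℚ(√-7)` rows
`deg ρ = 2`, `χ(G̃,G̃) = 14`, `G̃` has ODD type, so `e₂^ι(G̃) ≥ 13 > 12 = e₂^ι(F̄)` (`pushforward_summand_excludes`). Residual after this file: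
`G₀ × ι`-equivariant simple objects on `X` with `ch ∈ 2ℤ⁵` (even rank), `ι`-rigid descent, all `256` local indices zero; none is known.
ERRATUM (referee G70): rank-`0` members of the minimal orbit have `c₁ ∈ {±θ, ±7θ}` (`φ_{v_ω}`'s cubic factor is
`(2x+y)(2x²+2xy−3y²)`, e.g. `(0,7,−7,5,−3)`), so the ladder note's generic-ppav4 rank-`0` exclusion covers only the `c₁ = ±2θ` members of
the doubled row. ALL residual cases (every rank, every support) are excluded for `|G₀| ≤ 63` by the companion file
`SemiregularityIotaWindowVoid.lean` (determinant square + Lefschetz parity). -/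

section IotaWindowObjects

/-- **E2-corrected Table A, row `ℚ(√-3)`, `χ = 24` (`ch ∈ 2·(principal orbit)`, EVEN type: no odd-rank bound).** The design
equation `24 + χ_ι + 4e₁^ι = 28` with `χ_ι ≥ 0` even and `e₁^ι ≥ 0` admits exactly `(χ_ι, e₁^ι) ∈ {(4,0), (0,1)}`, i.e.
`Σ_{Y[2]} t_p² ∈ {64, 0}` and `dim Ext¹(F̄,F̄)^ι ≤ 1`. The same arithmetic is the `ℤ[√-3]`-order row (`χ = 24`). [folklore] -/
theorem tableA_chi24_even (χι e : ℤ) (h0 : 0 ≤ χι) (he : 0 ≤ e) (hpar : χι % 2 = 0) :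
    24 + χι + 4 * e = 28 ↔ (χι = 4 ∧ e = 0) ∨ (χι = 0 ∧ e = 1) := by
  omega

/-- **E2-corrected Table A, row `ℚ(i)`, `χ = 8`, EVEN orbit of `v_ω = (0,1,0,−1,0)` (the orbit of `x = ±1`; the orbit of
`x = ±i`, `v = (1,−2,3,−2,−7)`, is ODD and keeps only the first two pairs by `oddRank_design_void`).** [folklore] -/
theorem tableA_chi8_even (χι e : ℤ) (h0 : 0 ≤ χι) (he : 0 ≤ e) (hpar : χι % 2 = 0) :
    8 + χι + 4 * e = 28 ↔
      (χι = 20 ∧ e = 0) ∨ (χι = 16 ∧ e = 1) ∨ (χι = 12 ∧ e = 2) ∨ (χι = 8 ∧ e = 3) ∨ (χι = 4 ∧ e = 4) ∨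
        (χι = 0 ∧ e = 5) := by
  omega

/-- **E2-corrected Table A, row `ℚ(√-2)`, `χ = 16`, EVEN (`v_κ = (0,1,−8,46,−224) ∼ (0,1,0,−2,0)`).** [folklore] -/
theorem tableA_chi16_even (χι e : ℤ) (h0 : 0 ≤ χι) (he : 0 ≤ e) (hpar : χι % 2 = 0) :
    16 + χι + 4 * e = 28 ↔ (χι = 12 ∧ e = 0) ∨ (χι = 8 ∧ e = 1) ∨ (χι = 4 ∧ e = 2) ∨ (χι = 0 ∧ e = 3) := by
  omega

/-- **ODD rows at `|G₀| = 1`: `χ ∈ {6, 8}` survive with `(χ_ι,e₁^ι) ∈ {(28−χ−4e, e)}`, `χ_ι ≥ 16`; `χ ≥ 13` is void**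
(`oddRank_design_void`). For `χ = 6` (`ℚ(√-3)`, principal orbit): `(22,0), (18,1)`; for `χ = 8` (`ℚ(i)`, orbit of `±i`):
`(20,0), (16,1)`. [folklore] -/
theorem tableA_odd_rows (χ χι e : ℤ) (hχι : 16 ≤ χι) (he : 0 ≤ e) (hpar : (χι - χ) % 2 = 0) :
    (χ = 6 → (6 + χι + 4 * e = 28 ↔ (χι = 22 ∧ e = 0) ∨ (χι = 18 ∧ e = 1))) ∧
    (χ = 8 → (8 + χι + 4 * e = 28 ↔ (χι = 20 ∧ e = 0) ∨ (χι = 16 ∧ e = 1))) := by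
  constructor <;> intro hχ <;> subst hχ <;> omega

/-- **Quotient integrality (a), element of order 2.** If `2 ∣ v₁, v₂, v₃, v₄` (an element of order `2` in `G₀`; in fact
`2 ∣ v₂, v₄` suffice) then `4 ∣ Q(v)`. Hence the minimal `ℚ(√-7)` orbit (`Q = 14 ≡ 2 (mod 4)`) carries NO object invariant under
a translation of order `2`: habitat (H1) with `|G₀| ∈ {2, 14}` is void. [folklore] -/
theorem quotient_orderTwo_euler_mod_four (v₀ v₁ v₂ v₃ v₄ : ℤ) (h₂ : 2 ∣ v₂) (h₄ : 2 ∣ v₄) :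
    4 ∣ 2 * v₀ * v₄ - 8 * v₁ * v₃ + 6 * v₂ ^ 2 := by
  obtain ⟨a, rfl⟩ := h₂
  obtain ⟨b, rfl⟩ := h₄
  exact ⟨v₀ * b - 2 * v₁ * v₃ + 6 * a ^ 2, by ring⟩

/-- Corollary: `Q(v) = 14` is incompatible with an element of order `2` in `G₀`. [folklore] -/
theorem sqrtMinus7_minimal_no_orderTwo (v₀ v₁ v₂ v₃ v₄ : ℤ) (h₂ : 2 ∣ v₂) (h₄ : 2 ∣ v₄) :
    2 * v₀ * v₄ - 8 * v₁ * v₃ + 6 * v₂ ^ 2 ≠ 14 := by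
  intro h
  have := quotient_orderTwo_euler_mod_four v₀ v₁ v₂ v₃ v₄ h₂ h₄
  omega

/-- **Quotient integrality (a), element of order 7, minimal `ℚ(√-7)` orbit.** Every class of the orbit is `±` an
`M = (a b; c d) ∈ GL₂(ℤ)`-transform of `v(1) = (0, 1, −7, 35, −147) ≡ (0,1,0,0,0) (mod 7)` (`φ_v ≡ 4x³y`); the transform is
linear in `v`, so modulo `7` it is `v' ≡ (4a³c, 3a²bc + a³d, 2ab²c + 2a²bd, b³c + 3ab²d, 4b³d)`. An element of order `7` in `G₀`
needs `7 ∣ v'₁, v'₂, v'₃, v'₄`, i.e. `φ_{v'} ≡ v'₀x⁴ (mod 7)` — impossible, since `φ_v (mod 7)` has a simple root (`4b³d = 0`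
forces `b = 0` or `d = 0`, and then `v'₁ = a³d` resp. `v'₃ = b³c` kills the determinant). Hence habitat (H1) with `|G₀| = 7`
(and every `G₀` of order divisible by `7`) is void for the minimal orbit. [folklore] -/
theorem sqrtMinus7_minimal_no_orderSeven (a b c d : ZMod 7) (hdet : a * d - b * c = 1 ∨ a * d - b * c = -1) :
    ¬ (3 * a ^ 2 * b * c + a ^ 3 * d = 0 ∧ 2 * a * b ^ 2 * c + 2 * a ^ 2 * b * d = 0 ∧
        b ^ 3 * c + 3 * a * b ^ 2 * d = 0 ∧ 4 * b ^ 3 * d = 0) := by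
  revert a b c d hdet
  decide

/-- **Quotient integrality, groups of order 4, row `Q = 28` (`N(x) = 2`, ODD).** Both `ℤ/4` (`4 ∣ v₁,…,v₄`) and `(ℤ/2)²`
(`2 ∣ v₁`, `4 ∣ v₂, v₃, v₄`) give `2 ∣ v₂` and `4 ∣ v₄`, whence `8 ∣ Q(v)`; but `28 ≢ 0 (mod 8)`. With `|G₀| ∈ {7, 14, 28}`
excluded by the order-7 analysis (`7 ∤ N(x)`, ladder note) the whole row is void. [folklore] -/
theorem quotient_orderFour_euler_mod_eight (v₀ v₁ v₂ v₃ v₄ : ℤ) (h₂ : 2 ∣ v₂) (h₄ : 4 ∣ v₄) :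
    8 ∣ 2 * v₀ * v₄ - 8 * v₁ * v₃ + 6 * v₂ ^ 2 ∧ 2 * v₀ * v₄ - 8 * v₁ * v₃ + 6 * v₂ ^ 2 ≠ 28 := by
  obtain ⟨a, rfl⟩ := h₂
  obtain ⟨b, rfl⟩ := h₄
  refine ⟨⟨v₀ * b - v₁ * v₃ + 3 * a ^ 2, by ring⟩, ?_⟩
  intro h
  have : (8 : ℤ) ∣ 2 * v₀ * (4 * b) - 8 * v₁ * v₃ + 6 * (2 * a) ^ 2 := ⟨v₀ * b - v₁ * v₃ + 3 * a ^ 2, by ring⟩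
  omega

/-- **The doubled minimal class `v = 2w` (`Q(v) = 56`, EVEN) admits no group of order 4.** A group of order `4` forces
`4 ∣ v₂, v₃, v₄`, i.e. `2 ∣ w₂, w₃, w₄`, and then `Q(w) = 2w₀w₄ − 8w₁w₃ + 6w₂² ≡ 4·w₀(w₄/2) ∈ {0, 4} (mod 8)`, whereas
`Q(w) = 14 ≡ 6 (mod 8)`. (At `|G₀| = 2` the class `2w` passes integrality; there `χ(F̄,F̄) = 28`, see
`chibar_twentyEight_rigid`.) [folklore] -/
theorem sqrtMinus7_doubled_no_orderFour (w₀ w₁ w₂ w₃ w₄ : ℤ) (h₂ : 2 ∣ w₂) (h₃ : 2 ∣ w₃) (h₄ : 2 ∣ w₄) :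
    2 * w₀ * w₄ - 8 * w₁ * w₃ + 6 * w₂ ^ 2 ≠ 14 := by
  obtain ⟨a, rfl⟩ := h₂
  obtain ⟨b, rfl⟩ := h₃
  obtain ⟨c, rfl⟩ := h₄
  intro h
  have e : 2 * w₀ * (2 * c) - 8 * w₁ * (2 * b) + 6 * (2 * a) ^ 2 = 4 * (w₀ * c) - 16 * (w₁ * b) + 24 * (a ^ 2) := by
    ring
  rw [e] at h
  omega

/-- **`χ(F̄,F̄) = 28` forces `ι`-rigidity and vanishing local indices.** In every surviving quotient row for `ℚ(√-7)`
(`v ∈ 2ℤ⁵`, `|G₀| = N(x)/2`) one has `χ(F̄,F̄) = Q/|G₀| = 28`, so the design equation leaves only `χ_ι = 0` (all `256` local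
Lefschetz indices `t_p = 0`) and `e₁^ι = 0` (`Ext¹(F̄,F̄)^ι = 0`). [folklore] -/
theorem chibar_twentyEight_rigid (χι e : ℤ) (h0 : 0 ≤ χι) (he : 0 ≤ e) (h : 28 + χι + 4 * e = 28) :
    χι = 0 ∧ e = 0 := by
  constructor <;> omega

/-- **Push-forward exclusion (PF).** If `F̄ = ρ_*G̃` for an `ι`-compatible étale double cover and `G̃` has ODD type, then
`Ext²(F̄,F̄)^ι ⊇ Ext²(G̃,G̃)^ι` with `2e₂^ι(G̃) = χ(G̃,G̃) + χ_ι(G̃,G̃) − 4 + 4e₁^ι(G̃)` (`ext_two_inv_eq`), `χ(G̃,G̃) =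
χ(F̄,F̄)/2 = 14` and `χ_ι(G̃,G̃) ≥ 16`: so `e₂^ι(F̄) ≥ e₂^ι(G̃) ≥ 13 > 12`, and `F̄` is not `ι`-semiregular (which needs
`e₂^ι(F̄) = 12`). [cite: AtiyahBott1968, §4 (holomorphic Lefschetz formula)] -/
theorem pushforward_summand_excludes (χG χιG e₁G e₂G e₂F : ℤ) (hG : 2 * e₂G = χG + χιG - 4 + 4 * e₁G)
    (hχ : χG = 14) (hχι : 16 ≤ χιG) (he₁ : 0 ≤ e₁G) (hsum : e₂G ≤ e₂F) : 13 ≤ e₂F ∧ e₂F ≠ 12 := by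
  constructor <;> omega

end IotaWindowObjects

end Literature.AlgebraicGeometry.HodgeTheory
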